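import Summits.AtomisticToContinuum.BoseEinsteinCondensation.Theorems.BECSubharmonicContinuationHarmonicMinorantCorr

/-!
# Route BECSubharmonicContinuation · support `HarmonicMinorant` (stmt-AtomisticToContinuum-9003), II:
# regularity of the coherence of a periodic trial state

Helper file. For a periodic `C¹` trial state `Ψ` (`PeriodicTrialState N L`) and a slot `i`, the
complex correlation `P(y) = ∫_{cell} conj Ψ(X + y e_i) Ψ(X) dX`:

* `fderiv_corr_psi` — `∂_v P(y) = -∫ conj Ψ(X + y e_i) ∂_{v e_i}Ψ(X) dX` (differentiate under the
  integral, then integrate by parts on the torus so that only first derivatives of `Ψ` appear);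
* `contDiff_two_corr_psi` — hence `P ∈ C²(ℝ³)` although `Ψ` is only `C¹`, and
  `fderiv_fderiv_corr_psi` — `∂_{v'}∂_v P(y) = -∫ conj ∂_{v' e_i}Ψ(X + y e_i) ∂_{v e_i}Ψ(X) dX`;
* `abs_kineticCoherence_le` — `|H(y)| ≤ H(0)` for the kinetic coherence
  `H(y) = Re Σ_k ∫ conj ∂_{i,k}Ψ(X + y e_i) ∂_{i,k}Ψ(X)` (polarisation `2|Re conj α β| ≤ |α|²+|β|²`
  and translation invariance of `∫_{cell} |∂Ψ|²`, `integral_cellN_comp_equivariant`);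
* `re_corr_psi_zero` — `Re P(0) = ∫_{cell}|Ψ|² = 1`.

## References

* D. Gilbarg, N. S. Trudinger, *Elliptic Partial Differential Equations of Second Order*
  (Springer 2001), Thm 2.1 (mean value), (2.10)–(2.17) (Green's identities and representation)
  [GilbargTrudinger2001].
* E. H. Lieb, R. Seiringer, J. P. Solovej, J. Yngvason, *The Mathematics of the Bose Gas and its
  Condensation* (2005), §1.2 (1.17)–(1.19) (one-body density matrix) [LiebSeiringerSolovejYngvason2005].
-/

noncomputable section

open MeasureTheory Filter Metric Set Function Real InnerProductSpace
open scoped ComplexConjugate Topology RealInnerProductSpace Laplacian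

namespace Summit.AtomisticToContinuum.BoseEinsteinCondensation.Theorems

namespace HarmonicMinorant

open Literature.MathematicalPhysics.QuantumManyBody.BoseGas

variable {N : ℕ} {L : ℝ}

/-! ### The density-matrix correlation of a periodic trial state -/

section TrialState

variable (Ψ : PeriodicTrialState N L) (i : Fin N)

/-- Directional derivatives of the wave function are continuous. [folklore] -/
theorem continuous_fderiv_psi (w : Config N) : Continuous fun X => fderiv ℝ Ψ.ψ X w :=
  continuous_fderiv_apply_const Ψ.contDiff w

/-- Directional derivatives of the wave function are periodic. [folklore] -/
theorem fderiv_psi_periodic (w : Config N) (X : Config N) (j : Fin N) (c : Fin 3) :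
    fderiv ℝ Ψ.ψ (X + Pi.single j (EuclideanSpace.single c L)) w = fderiv ℝ Ψ.ψ X w :=
  fderiv_apply_periodic Ψ.periodic w X j c

/-- **First derivative of the complex correlation**
`P(y) = ∫ conj Ψ(X + y e_i) Ψ(X) dX`: `∂_v P(y) = -∫ conj Ψ(X + y e_i) ∂_{v e_i}Ψ(X) dX`
(differentiate under the integral and integrate by parts on the torus). [folklore] -/
theorem fderiv_corr_psi (hL : 0 < L) (y v : Space) :
    fderiv ℝ (fun y : Space => ∫ X in cellN N L,
        conj (Ψ.ψ (X + (Pi.single i y : Config N))) * Ψ.ψ X) y v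
      = -∫ X in cellN N L, conj (Ψ.ψ (X + (Pi.single i y : Config N))) *
          fderiv ℝ Ψ.ψ X (Pi.single i v : Config N) := by
  rw [fderiv_corr_apply i Ψ.contDiff Ψ.contDiff.continuous y v,
    corr_fderiv_left_eq_neg hL i Ψ.contDiff Ψ.contDiff Ψ.periodic Ψ.periodic y (Pi.single i v)]

/-- The first-derivative correlation `y ↦ ∫ conj Ψ(X + y e_i) ∂_w Ψ(X) dX` is `C¹`. [folklore] -/
theorem contDiff_one_corr_psi_fderiv (w : Config N) :
    ContDiff ℝ 1 (fun y : Space => ∫ X in cellN N L,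
      conj (Ψ.ψ (X + (Pi.single i y : Config N))) * fderiv ℝ Ψ.ψ X w) := by
  have hb : Continuous fun X => fderiv ℝ Ψ.ψ X w := continuous_fderiv_psi Ψ w
  refine contDiff_one_iff_hasFDerivAt.2 ⟨_, ?_, fun y => hasFDerivAt_corr i Ψ.contDiff hb y⟩
  refine continuous_clm_apply.2 fun u => ?_
  have h : (fun y : Space => (∫ X in cellN N L, fderiv ℝ Ψ.ψ X w •
      ((Complex.conjCLE : ℂ →L[ℝ] ℂ).comp
        ((fderiv ℝ Ψ.ψ (X + (Pi.single i y : Config N))).comp (ContinuousLinearMap.single ℝ (fun _ : Fin N => Space) i : Space →L[ℝ] Config N)))) u) =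
      fun y => ∫ X in cellN N L, conj (fderiv ℝ Ψ.ψ (X + (Pi.single i y : Config N))
        (Pi.single i u : Config N)) * fderiv ℝ Ψ.ψ X w := by
    funext y
    rw [ContinuousLinearMap.integral_apply (integrable_corr_deriv i Ψ.contDiff hb y)]
    refine integral_congr_ae (Eventually.of_forall fun X => ?_)
    show (fderiv ℝ Ψ.ψ X w • ((Complex.conjCLE : ℂ →L[ℝ] ℂ).comp
        ((fderiv ℝ Ψ.ψ (X + (Pi.single i y : Config N))).comp (ContinuousLinearMap.single ℝ (fun _ : Fin N => Space) i : Space →L[ℝ] Config N)))) u = _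
    rw [smul_conj_comp_slot_apply, mul_comm]
  rw [h]
  exact continuous_corr i (continuous_fderiv_psi Ψ (Pi.single i u)) hb

/-- **The complex correlation is `C²`.** [folklore] -/
theorem contDiff_two_corr_psi (hL : 0 < L) :
    ContDiff ℝ 2 (fun y : Space => ∫ X in cellN N L,
      conj (Ψ.ψ (X + (Pi.single i y : Config N))) * Ψ.ψ X) := by
  rw [show (2 : WithTop ℕ∞) = 1 + 1 from rfl, contDiff_succ_iff_fderiv_apply]
  refine ⟨differentiable_corr i Ψ.contDiff Ψ.contDiff.continuous, fun h => ?_, fun v => ?_⟩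
  · exact absurd h (by simp)
  · have h : (fun y : Space => fderiv ℝ (fun y : Space => ∫ X in cellN N L,
        conj (Ψ.ψ (X + (Pi.single i y : Config N))) * Ψ.ψ X) y v) =
        fun y => -∫ X in cellN N L, conj (Ψ.ψ (X + (Pi.single i y : Config N))) *
          fderiv ℝ Ψ.ψ X (Pi.single i v : Config N) :=
      funext fun y => fderiv_corr_psi Ψ i hL y v
    rw [h]
    exact (contDiff_one_corr_psi_fderiv Ψ i (Pi.single i v)).neg

/-- **Second directional derivatives of the complex correlation**:
`∂_{v'} ∂_v P(y) = -∫ conj ∂_{v' e_i}Ψ(X + y e_i) ∂_{v e_i}Ψ(X) dX`. [folklore] -/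
theorem fderiv_fderiv_corr_psi (hL : 0 < L) (y v v' : Space) :
    fderiv ℝ (fun y : Space => fderiv ℝ (fun y : Space => ∫ X in cellN N L,
        conj (Ψ.ψ (X + (Pi.single i y : Config N))) * Ψ.ψ X) y v) y v' =
      -∫ X in cellN N L, conj (fderiv ℝ Ψ.ψ (X + (Pi.single i y : Config N))
          (Pi.single i v' : Config N)) * fderiv ℝ Ψ.ψ X (Pi.single i v : Config N) := by
  have h : (fun y : Space => fderiv ℝ (fun y : Space => ∫ X in cellN N L,
      conj (Ψ.ψ (X + (Pi.single i y : Config N))) * Ψ.ψ X) y v) =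
      fun y => -∫ X in cellN N L, conj (Ψ.ψ (X + (Pi.single i y : Config N))) *
        fderiv ℝ Ψ.ψ X (Pi.single i v : Config N) :=
    funext fun y => fderiv_corr_psi Ψ i hL y v
  rw [h, fderiv_fun_neg, neg_apply,
    fderiv_corr_apply i Ψ.contDiff (continuous_fderiv_psi Ψ _) y v']

/-! ### Translation invariance and the kinetic-coherence bounds -/

/-- **Torus translation invariance of cell integrals** (Bochner form, translation in one slot):
`∫_{cell} f(X + y e_i) dX = ∫_{cell} f(X) dX` for `f` periodic in every particle. [folklore] -/
theorem integral_cellN_comp_add_single (hL : 0 < L) {W : Type*} [NormedAddCommGroup W]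
    [NormedSpace ℝ W] {f : Config N → W}
    (hper : ∀ (X : Config N) (j : Fin N) (c : Fin 3),
      f (X + Pi.single j (EuclideanSpace.single c L)) = f X) (y : Space) :
    ∫ X in cellN N L, f (X + (Pi.single i y : Config N)) = ∫ X in cellN N L, f X := by
  have h := integral_cellN_comp_equivariant hL (F := fun X : Config N => X + (Pi.single i y : Config N))
    (F' := fun _ => ContinuousLinearMap.id ℝ (Config N))
    (fun X => ((ContinuousLinearMap.id ℝ (Config N)).hasFDerivAt).add_const _)
    ⟨fun X Y hXY => by simpa using hXY, fun Z => ⟨Z - Pi.single i y, by simp⟩⟩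
    (fun X j c => by rw [add_right_comm]) hper
  have hdet : (ContinuousLinearMap.id ℝ (Config N)).det = 1 := by
    simp [ContinuousLinearMap.det]
  simpa [hdet] using h

/-- Real part of a cell integral of an integrable complex function. [folklore] -/
theorem re_setIntegral_cellN {f : Config N → ℂ} (hf : Integrable f (volume.restrict (cellN N L))) :
    (∫ X in cellN N L, f X).re = ∫ X in cellN N L, (f X).re := by
  rw [← Complex.reCLM_apply (∫ X in cellN N L, f X), ← ContinuousLinearMap.integral_comp_comm _ hf]
  simp only [Complex.reCLM_apply]

/-- Pointwise polarisation bound: `-(‖α‖² + ‖β‖²)/2 ≤ Re(conj α · β) ≤ (‖α‖² + ‖β‖²)/2`.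
[folklore] -/
theorem abs_re_conj_mul_le (α β : ℂ) :
    |(conj α * β).re| ≤ (‖α‖ ^ 2 + ‖β‖ ^ 2) / 2 := by
  rw [Complex.sq_norm, Complex.sq_norm, Complex.normSq_apply, Complex.normSq_apply]
  have h : (conj α * β).re = α.re * β.re + α.im * β.im := by
    simp [Complex.mul_re]
  rw [h, abs_le]
  constructor
  · nlinarith [sq_nonneg (α.re + β.re), sq_nonneg (α.im + β.im)]
  · nlinarith [sq_nonneg (α.re - β.re), sq_nonneg (α.im - β.im)]

/-- `Re(conj α · α) = ‖α‖²`. [folklore] -/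
theorem re_conj_mul_self (α : ℂ) : (conj α * α).re = ‖α‖ ^ 2 := by
  rw [Complex.sq_norm, Complex.normSq_apply]
  simp [Complex.mul_re]

/-- **The kinetic coherence is dominated by the kinetic energy**: for every `y`,
`|Re Σ_k ∫ conj ∂_{i,k}Ψ(X + y e_i) ∂_{i,k}Ψ(X) dX| ≤ Re Σ_k ∫ conj ∂_{i,k}Ψ(X) ∂_{i,k}Ψ(X) dX`
(polarisation `2|Re conj α β| ≤ |α|² + |β|²` and translation invariance of `∫_{cell}|∂Ψ|²`).
[folklore] -/
theorem abs_kineticCoherence_le (hL : 0 < L) (y : Space) :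
    |(∑ k : Fin 3, ∫ X in cellN N L,
        conj (fderiv ℝ Ψ.ψ (X + (Pi.single i y : Config N))
          (Pi.single i (EuclideanSpace.single k (1 : ℝ))))
        * fderiv ℝ Ψ.ψ X (Pi.single i (EuclideanSpace.single k (1 : ℝ)))).re| ≤
      (∑ k : Fin 3, ∫ X in cellN N L,
        conj (fderiv ℝ Ψ.ψ X (Pi.single i (EuclideanSpace.single k (1 : ℝ))))
          * fderiv ℝ Ψ.ψ X (Pi.single i (EuclideanSpace.single k (1 : ℝ)))).re := by
  rw [Complex.re_sum, Complex.re_sum]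
  refine (Finset.abs_sum_le_sum_abs _ _).trans (Finset.sum_le_sum fun k _ => ?_)
  set w : Config N := Pi.single i (EuclideanSpace.single k (1 : ℝ)) with hw
  have hc : Continuous fun X => fderiv ℝ Ψ.ψ X w := continuous_fderiv_psi Ψ w
  have htr : Continuous fun X : Config N => X + (Pi.single i y : Config N) :=
    continuous_id.add continuous_const
  have hi1 : Integrable (fun X => conj (fderiv ℝ Ψ.ψ (X + (Pi.single i y : Config N)) w) *
      fderiv ℝ Ψ.ψ X w) (volume.restrict (cellN N L)) :=
    integrableOn_cellN ((Complex.continuous_conj.comp (hc.comp htr)).mul hc) L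
  have hi0 : Integrable (fun X => conj (fderiv ℝ Ψ.ψ X w) * fderiv ℝ Ψ.ψ X w)
      (volume.restrict (cellN N L)) :=
    integrableOn_cellN ((Complex.continuous_conj.comp hc).mul hc) L
  rw [re_setIntegral_cellN hi1, re_setIntegral_cellN hi0]
  have hsq : ∀ X, (conj (fderiv ℝ Ψ.ψ X w) * fderiv ℝ Ψ.ψ X w).re = ‖fderiv ℝ Ψ.ψ X w‖ ^ 2 :=
    fun X => re_conj_mul_self _
  simp_rw [hsq]
  -- translation invariance of `∫ |∂Ψ|²`
  have htrans : ∫ X in cellN N L, ‖fderiv ℝ Ψ.ψ (X + (Pi.single i y : Config N)) w‖ ^ 2 =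
      ∫ X in cellN N L, ‖fderiv ℝ Ψ.ψ X w‖ ^ 2 :=
    integral_cellN_comp_add_single i hL (f := fun X => ‖fderiv ℝ Ψ.ψ X w‖ ^ 2)
      (fun X j c => by rw [fderiv_psi_periodic]) y
  have hiA : Integrable (fun X => ‖fderiv ℝ Ψ.ψ (X + (Pi.single i y : Config N)) w‖ ^ 2)
      (volume.restrict (cellN N L)) := integrableOn_cellN ((hc.comp htr).norm.pow 2) L
  have hiB : Integrable (fun X => ‖fderiv ℝ Ψ.ψ X w‖ ^ 2) (volume.restrict (cellN N L)) :=
    integrableOn_cellN (hc.norm.pow 2) L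
  calc |∫ X in cellN N L, (conj (fderiv ℝ Ψ.ψ (X + (Pi.single i y : Config N)) w) *
          fderiv ℝ Ψ.ψ X w).re|
      ≤ ∫ X in cellN N L, |(conj (fderiv ℝ Ψ.ψ (X + (Pi.single i y : Config N)) w) *
          fderiv ℝ Ψ.ψ X w).re| := abs_integral_le_integral_abs
    _ ≤ ∫ X in cellN N L, (‖fderiv ℝ Ψ.ψ (X + (Pi.single i y : Config N)) w‖ ^ 2 +
          ‖fderiv ℝ Ψ.ψ X w‖ ^ 2) / 2 := by
        refine integral_mono_of_nonneg (Eventually.of_forall fun X => abs_nonneg _)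
          ((hiA.add hiB).div_const 2) (Eventually.of_forall fun X => abs_re_conj_mul_le _ _)
    _ = ∫ X in cellN N L, ‖fderiv ℝ Ψ.ψ X w‖ ^ 2 := by
        rw [integral_div, integral_add hiA hiB, htrans]
        ring

/-- **Normalisation**: `Re ∫ conj Ψ(X) Ψ(X) dX = 1`. [folklore] -/
theorem re_corr_psi_zero :
    (∫ X in cellN N L, conj (Ψ.ψ (X + (Pi.single i (0 : Space) : Config N))) * Ψ.ψ X).re = 1 := by
  simp only [Pi.single_zero, add_zero]
  have hi : Integrable (fun X => conj (Ψ.ψ X) * Ψ.ψ X) (volume.restrict (cellN N L)) :=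
    integrableOn_cellN ((Complex.continuous_conj.comp Ψ.contDiff.continuous).mul
      Ψ.contDiff.continuous) L
  rw [re_setIntegral_cellN hi]
  simp_rw [re_conj_mul_self]
  have h1 := Ψ.norm_eq
  have h2 : ∫⁻ X in cellN N L, ((‖Ψ.ψ X‖₊ : ENNReal)) ^ 2 =
      ENNReal.ofReal (∫ X in cellN N L, ‖Ψ.ψ X‖ ^ 2) := by
    have h3 : ∀ X, ((‖Ψ.ψ X‖₊ : ENNReal)) ^ 2 = ENNReal.ofReal (‖Ψ.ψ X‖ ^ 2) := fun X => by
      rw [ENNReal.ofReal_pow (norm_nonneg _), ofReal_norm, enorm_eq_nnnorm]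
    simp_rw [h3]
    rw [← ofReal_integral_eq_lintegral_ofReal]
    · exact integrableOn_cellN (Ψ.contDiff.continuous.norm.pow 2) L
    · exact Eventually.of_forall fun X => sq_nonneg _
  rw [h2] at h1
  have h4 : 0 ≤ ∫ X in cellN N L, ‖Ψ.ψ X‖ ^ 2 := integral_nonneg fun X => sq_nonneg _
  have h5 := ENNReal.toReal_ofReal h4
  rw [h1, ENNReal.toReal_one] at h5
  exact h5.symm

end TrialState

end HarmonicMinorant

end Summit.AtomisticToContinuum.BoseEinsteinCondensation.Theorems
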